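import Summits.CriticalPhenomena.PercolationContinuityZ3.Theorems.PercNearOneGluingNoHeavyLowerTailNineTypeCellCount

/-!
# The complementary-pair packing `U` (and its Z-tight sibling `S3`): kernels, fibre counts, law-level reductions

Support file for crux `stmt-CriticalPhenomena-4575` (master-family programme, Conjecture W = row `Q44` ∀`n` and its law-level
siblings), seat `prim-bnk-1` gen 35; memos `run/shared/lean/prim/prim-l12/FROM-prim-bnk-1-gen34-W-ZERO-VARIETY.md` §8 and
`FROM-prim-bnk-1-gen35-U-PACKING-HALL.md`.

Cells `cᵢ = FourPointAtoms.cell w a b c y i` in `pat4` order (`0 a|b|c|y, 1 a|b|cy, 2 a|by|c, 3 a|bc|y, 4 ay|b|c, 5 ac|b|y,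
6 ab|c|y, 7 a|bcy, 8 ay|bc, 9 ac|by, 10 acy|b, 11 ab|cy, 12 aby|c, 13 abc|y, 14 abcy`).  Two partitions `π, σ` of the marked
points are COMPLEMENTARY if `π ∧ σ = 0̂` and `π ∨ σ = 1̂`; for each such pair `P(π)P(σ) ≤ P(0̂)P(1̂)` is a theorem
(Ahlswede–Daykin, `…FourPointComplementaryPairs`).  The PACKING `U` of `prim-bnk-1` gen 34 puts TEN half-units of
complementary products under ONE `P(0̂)P(1̂)`:

  `U := c₀c₁₄ − c₁₁·(c₂+c₃+c₄+c₅+c₈+c₉) − ½[c₂(c₁₀+c₁₃) + c₃(c₁₀+c₁₂) + c₄(c₇+c₁₃) + c₅(c₇+c₁₂)] ≥ 0`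

(the six complements `D°` of `ab|cy`, weight 1; the eight DARTS `(p, t)` = (crossing pair, three-block containing exactly one
end of `p`), weight ½), and `S3 := U + c₀c₁₁ − c₁c₆` (`= U − δ(ab|cy)`, `δ` the type-A exchange defect) is the `D₈`-symmetric
Z-tight sibling of `W = 2·Q44` (`W = 2S3 − 2S4`).  Status (not claimed here as theorems): `U, S3 ≥ 0` have 0 negatives on
2.1·10⁹ exact instances (ttrl cp-key2 j219989/990), on all 70 807 209 monotone maps of `B₄` and all 97 127 035 unit-step maps of
`B₅`; `U` has an exact pseudo-law against every law-level row in the tree (kit j219827), so it is NOT a consequence of the known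
dictionary.  This file is the SOCKET for the fibre route, parallel to `…Q44WeightedCount` (Conjecture W):

* `TwoCopyMono.indK`, `sum_indK_cell` — indicator kernel of a set of ordered cell pairs and its evaluation (bookkeeping);
* `TwoCopyMono.kerU`, `sum_kerU_cell` — the integer kernel with `Σ κᵢⱼ cᵢcⱼ = 4·U`;
* `TwoCopyMono.goodKernel_kerU_iff_count` — **the fibre statement**: `kerU` is good iff for every monotone cell map `ι` on the
  subsets of a finite type, `2·#{T : ι T = ab|cy, ι Tᶜ ∈ D°} + #{T : (ι T, ι Tᶜ) a dart} ≤ 2·#{T : ι T = 1̂, ι Tᶜ = 0̂}`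
  ("`2g ≥ 2f + h`"; verified on all of `B₄`; the one-sided capacity-2 Hall system HALL-U behind it holds on all of `B₄` and for
  all 23 117 100 order-consistent abstract typed configurations on ≤ 5 points, memo gen 35 §2);
* `TwoCopyMono.packU_of_goodKernel` — **the reduction**: `GoodKernel kerU → U ≥ 0` on every finite weighted graph, all `n`;
* `TwoCopyMono.kerS3`, `sum_kerS3_cell`, `packS3_of_goodKernel` — the same for `S3`.
No sorries, no named facts, standard axioms; the hypotheses of the reductions are the open combinatorial statements.
-/

namespace Summit.CriticalPhenomena.PercolationContinuityZ3.Theorems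

namespace TwoCopyMono

open Finset FourPointAtoms

/-! ## Indicator kernels of sets of ordered cell pairs -/

/-- Indicator kernel of a set of ordered cell pairs. [this work] -/
def indK (P : Finset (Fin 15 × Fin 15)) (i j : Fin 15) : ℤ := if (i, j) ∈ P then 1 else 0

/-- Evaluation of an indicator kernel on a cell vector: `Σᵢⱼ [(i,j) ∈ P] cᵢ cⱼ = Σ_{(i,j) ∈ P} cᵢ cⱼ`. [this work] -/
theorem sum_indK_cell (P : Finset (Fin 15 × Fin 15)) (c : Fin 15 → ℝ) :
    (∑ i : Fin 15, ∑ j : Fin 15, (indK P i j : ℝ) * c i * c j) = ∑ p ∈ P, c p.1 * c p.2 := by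
  classical
  have h1 : ∀ i j : Fin 15, (indK P i j : ℝ) * c i * c j = if (i, j) ∈ P then c i * c j else 0 := by
    intro i j; unfold indK; split_ifs <;> simp
  simp_rw [h1]
  rw [← Finset.sum_product' (s := (Finset.univ : Finset (Fin 15))) (t := (Finset.univ : Finset (Fin 15)))
    (f := fun i j => if (i, j) ∈ P then c i * c j else 0), Finset.univ_product_univ, Finset.sum_ite_mem, Finset.univ_inter]

/-- The antipodal count of an indicator kernel along a cell map is the number of points of the given pair types. [this work] -/
theorem sum_indK_map {γ : Type*} [Fintype γ] [DecidableEq γ] (P : Finset (Fin 15 × Fin 15)) (ι : Finset γ → Fin 15) :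
    (∑ T : Finset γ, indK P (ι T) (ι Tᶜ)) = (#(Finset.univ.filter fun T => (ι T, ι Tᶜ) ∈ P) : ℤ) := by
  unfold indK
  rw [Finset.sum_boole]

/-- Swapping the two sides of the antipodal pairs does not change a point count. [this work] -/
theorem card_filter_compl_swap {γ : Type*} [Fintype γ] [DecidableEq γ] (ι : Finset γ → Fin 15)
    (Q : Fin 15 → Fin 15 → Prop) [DecidablePred fun T : Finset γ => Q (ι T) (ι Tᶜ)]
    [DecidablePred fun T : Finset γ => Q (ι Tᶜ) (ι T)] :
    #(Finset.univ.filter fun T => Q (ι Tᶜ) (ι T)) = #(Finset.univ.filter fun T => Q (ι T) (ι Tᶜ)) := by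
  refine Finset.card_bij (fun T _ => Tᶜ) (fun T hT => ?_) (fun T₁ _ T₂ _ h => compl_injective h) (fun T hT => ?_)
  · rw [Finset.mem_filter] at hT ⊢
    refine ⟨Finset.mem_univ _, ?_⟩
    rw [compl_compl]; exact hT.2
  · refine ⟨Tᶜ, ?_, compl_compl T⟩
    rw [Finset.mem_filter] at hT ⊢
    refine ⟨Finset.mem_univ _, ?_⟩
    rw [compl_compl]; exact hT.2

/-! ## The kernel of `4·U` -/

/-- The good pair `(1̂, 0̂)` in both orientations. [this work] -/
def uTop : Finset (Fin 15 × Fin 15) := {(14, 0), (0, 14)}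

/-- The six `B`-pairs of `U`: `ab|cy` against its complements `D° = {a|by|c, a|bc|y, ay|b|c, ac|b|y, ay|bc, ac|by}`, both
orientations. [this work] -/
def uB : Finset (Fin 15 × Fin 15) :=
  {(11, 2), (2, 11), (11, 3), (3, 11), (11, 4), (4, 11), (11, 5), (5, 11), (11, 8), (8, 11), (11, 9), (9, 11)}

/-- The eight darts of `U` (crossing pair ; three-block containing exactly one end of the pair), both orientations:
`by;acy`, `by;abc`, `bc;acy`, `bc;aby`, `ay;bcy`, `ay;abc`, `ac;bcy`, `ac;aby`. [this work] -/
def uD : Finset (Fin 15 × Fin 15) :=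
  {(2, 10), (10, 2), (2, 13), (13, 2), (3, 10), (10, 3), (3, 12), (12, 3), (4, 7), (7, 4), (4, 13), (13, 4),
    (5, 7), (7, 5), (5, 12), (12, 5)}

/-- **The integer kernel of `4·U`**: `2·[uTop] − 2·[uB] − [uD]`. [this work] -/
def kerU (i j : Fin 15) : ℤ := 2 * indK uTop i j - 2 * indK uB i j - indK uD i j

/-- Evaluation: `Σ κᵢⱼ cᵢ cⱼ = 4·U(c)`. [this work] -/
theorem sum_kerU_cell (c : Fin 15 → ℝ) :
    (∑ i : Fin 15, ∑ j : Fin 15, (kerU i j : ℝ) * c i * c j) =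
      4 * (c 0 * c 14) - 4 * (c 11 * (c 2 + c 3 + c 4 + c 5 + c 8 + c 9)) -
        2 * (c 2 * (c 10 + c 13) + c 3 * (c 10 + c 12) + c 4 * (c 7 + c 13) + c 5 * (c 7 + c 12)) := by
  have hsplit : ∀ i j : Fin 15, (kerU i j : ℝ) * c i * c j =
      2 * ((indK uTop i j : ℝ) * c i * c j) - 2 * ((indK uB i j : ℝ) * c i * c j) - (indK uD i j : ℝ) * c i * c j := by
    intro i j; unfold kerU; push_cast; ring
  simp_rw [hsplit, Finset.sum_sub_distrib, ← Finset.mul_sum]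
  rw [sum_indK_cell, sum_indK_cell, sum_indK_cell]
  have hT : (∑ p ∈ uTop, c p.1 * c p.2) = 2 * (c 0 * c 14) := by
    unfold uTop; rw [Finset.sum_insert (by decide), Finset.sum_singleton]; ring
  have hB : (∑ p ∈ uB, c p.1 * c p.2) = 2 * (c 11 * (c 2 + c 3 + c 4 + c 5 + c 8 + c 9)) := by
    unfold uB
    rw [Finset.sum_insert (by decide), Finset.sum_insert (by decide), Finset.sum_insert (by decide), Finset.sum_insert (by decide),
      Finset.sum_insert (by decide), Finset.sum_insert (by decide), Finset.sum_insert (by decide), Finset.sum_insert (by decide),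
      Finset.sum_insert (by decide), Finset.sum_insert (by decide), Finset.sum_insert (by decide), Finset.sum_singleton]
    ring
  have hD : (∑ p ∈ uD, c p.1 * c p.2) =
      2 * (c 2 * (c 10 + c 13) + c 3 * (c 10 + c 12) + c 4 * (c 7 + c 13) + c 5 * (c 7 + c 12)) := by
    unfold uD
    rw [Finset.sum_insert (by decide), Finset.sum_insert (by decide), Finset.sum_insert (by decide), Finset.sum_insert (by decide),
      Finset.sum_insert (by decide), Finset.sum_insert (by decide), Finset.sum_insert (by decide), Finset.sum_insert (by decide),
      Finset.sum_insert (by decide), Finset.sum_insert (by decide), Finset.sum_insert (by decide), Finset.sum_insert (by decide),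
      Finset.sum_insert (by decide), Finset.sum_insert (by decide), Finset.sum_insert (by decide), Finset.sum_singleton]
    ring
  rw [hT, hB, hD]; ring

/-! ## The fibre statement: `2g ≥ 2f + h` -/

/-- The antipodal sum of `kerU` along a cell map, in point counts (both orientations). [this work] -/
theorem sum_kerU_map {γ : Type*} [Fintype γ] [DecidableEq γ] (ι : Finset γ → Fin 15) :
    (∑ T : Finset γ, kerU (ι T) (ι Tᶜ)) =
      2 * (#(Finset.univ.filter fun T => (ι T, ι Tᶜ) ∈ uTop) : ℤ) - 2 * (#(Finset.univ.filter fun T => (ι T, ι Tᶜ) ∈ uB) : ℤ) -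
        (#(Finset.univ.filter fun T => (ι T, ι Tᶜ) ∈ uD) : ℤ) := by
  unfold kerU
  rw [Finset.sum_sub_distrib, Finset.sum_sub_distrib, ← Finset.mul_sum, ← Finset.mul_sum, sum_indK_map, sum_indK_map,
    sum_indK_map]

/-- **`GoodKernel kerU` is the count `2g ≥ 2f + h` (both orientations).**  `kerU` is good iff for every monotone map `ι` from
the subsets of a finite type to the 15 cells,
`2·#{T : (ι T, ι Tᶜ) ∈ uB} + #{T : (ι T, ι Tᶜ) ∈ uD} ≤ 2·#{T : (ι T, ι Tᶜ) ∈ uTop}`. [this work] -/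
theorem goodKernel_kerU_iff_count :
    GoodKernel kerU ↔
      ∀ (γ : Type) [Fintype γ] [DecidableEq γ] (ι : Finset γ → Fin 15),
        (∀ A B : Finset γ, A ⊆ B → ple (ι A) (ι B) = true) →
          2 * #(Finset.univ.filter fun T => (ι T, ι Tᶜ) ∈ uB) + #(Finset.univ.filter fun T => (ι T, ι Tᶜ) ∈ uD) ≤
            2 * #(Finset.univ.filter fun T => (ι T, ι Tᶜ) ∈ uTop) := by
  classical
  have hsum : ∀ (γ : Type) [Fintype γ] [DecidableEq γ] (ι : Finset γ → Fin 15),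
      (∑ T : Finset γ, liftK kerU (pp (ι T)) (pp (ι Tᶜ))) =
        2 * (#(Finset.univ.filter fun T => (ι T, ι Tᶜ) ∈ uTop) : ℤ) -
          2 * (#(Finset.univ.filter fun T => (ι T, ι Tᶜ) ∈ uB) : ℤ) -
            (#(Finset.univ.filter fun T => (ι T, ι Tᶜ) ∈ uD) : ℤ) := by
    intro γ _ _ ι
    have h1 : ∀ T : Finset γ, liftK kerU (pp (ι T)) (pp (ι Tᶜ)) = kerU (ι T) (ι Tᶜ) := fun T => liftK_pp _ _ _
    simp_rw [h1]
    exact sum_kerU_map ι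
  constructor
  · intro hK γ _ _ ι hmono
    have hmono' : ∀ A B : Finset γ, A ⊆ B → ProfLE (pp (ι A)) (pp (ι B)) :=
      fun A B hAB => profLE_of_ple (hmono A B hAB)
    have h0 : 0 ≤ ∑ T : Finset γ, liftK kerU (pp (ι T)) (pp (ι Tᶜ)) :=
      hK.nonneg γ (fun T => pp (ι T)) hmono' (fun T => isEqv_pp (ι T))
    rw [hsum γ ι] at h0
    have : 2 * (#(Finset.univ.filter fun T => (ι T, ι Tᶜ) ∈ uB) : ℤ) +
        (#(Finset.univ.filter fun T => (ι T, ι Tᶜ) ∈ uD) : ℤ) ≤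
          2 * (#(Finset.univ.filter fun T => (ι T, ι Tᶜ) ∈ uTop) : ℤ) := by linarith
    exact_mod_cast this
  · intro hcount
    refine ⟨fun γ _ _ P hmono heqv => ?_⟩
    have hex : ∀ T : Finset γ, ∃ i : Fin 15, P T = pp i := fun T => exists_pat_of_isEqv (heqv T)
    choose ι hι using hex
    have hle : ∀ A B : Finset γ, A ⊆ B → ple (ι A) (ι B) = true := by
      intro A B hAB
      apply ple_of_profLE
      rw [← hι A, ← hι B]
      exact hmono A B hAB
    have hc := hcount γ ι hle
    have hP : (∑ T : Finset γ, liftK kerU (P T) (P Tᶜ)) = ∑ T : Finset γ, liftK kerU (pp (ι T)) (pp (ι Tᶜ)) := by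
      refine Finset.sum_congr rfl fun T _ => ?_
      rw [hι T, hι Tᶜ]
    rw [hP, hsum γ ι]
    have : 2 * (#(Finset.univ.filter fun T => (ι T, ι Tᶜ) ∈ uB) : ℤ) +
        (#(Finset.univ.filter fun T => (ι T, ι Tᶜ) ∈ uD) : ℤ) ≤
          2 * (#(Finset.univ.filter fun T => (ι T, ι Tᶜ) ∈ uTop) : ℤ) := by exact_mod_cast hc
    linarith

/-! ## Law level -/

variable {n : ℕ}

/-- **`U ≥ 0` for all `n` from the count (the reduction).**  If `kerU` is a good kernel, then for every finite weighted graph and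
all marked points, `2·c₁₁(c₂+c₃+c₄+c₅+c₈+c₉) + [c₂(c₁₀+c₁₃)+c₃(c₁₀+c₁₂)+c₄(c₇+c₁₃)+c₅(c₇+c₁₂)] ≤ 2·c₀c₁₄`. [this work] -/
theorem packU_of_goodKernel (hK : GoodKernel kerU) (w : Sym2 (Fin n) → unitInterval) (a b c y : Fin n) :
    2 * (cell w a b c y 11 * (cell w a b c y 2 + cell w a b c y 3 + cell w a b c y 4 + cell w a b c y 5 + cell w a b c y 8 +
        cell w a b c y 9)) +
      (cell w a b c y 2 * (cell w a b c y 10 + cell w a b c y 13) + cell w a b c y 3 * (cell w a b c y 10 + cell w a b c y 12) +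
        cell w a b c y 4 * (cell w a b c y 7 + cell w a b c y 13) + cell w a b c y 5 * (cell w a b c y 7 + cell w a b c y 12)) ≤
      2 * (cell w a b c y 0 * cell w a b c y 14) := by
  have h := sum_kernel_cell_nonneg hK w a b c y
  rw [sum_kerU_cell] at h
  linarith

/-! ## The Z-tight sibling `S3 = U + c₀c₁₁ − c₁c₆` -/

/-- The extra good pair of `S3`: `(ab|cy, 0̂)`, both orientations. [this work] -/
def s3Top : Finset (Fin 15 × Fin 15) := {(11, 0), (0, 11)}

/-- The extra bad pair of `S3`: `(a|b|cy, ab|c|y)`, both orientations (NOT complementary: join `ab|cy`). [this work] -/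
def s3B : Finset (Fin 15 × Fin 15) := {(1, 6), (6, 1)}

/-- **The integer kernel of `4·S3`**: `kerU + 2·[s3Top] − 2·[s3B]`. [this work] -/
def kerS3 (i j : Fin 15) : ℤ := kerU i j + 2 * indK s3Top i j - 2 * indK s3B i j

/-- Evaluation: `Σ κᵢⱼ cᵢ cⱼ = 4·S3(c)`. [this work] -/
theorem sum_kerS3_cell (c : Fin 15 → ℝ) :
    (∑ i : Fin 15, ∑ j : Fin 15, (kerS3 i j : ℝ) * c i * c j) =
      4 * (c 0 * (c 11 + c 14)) - 4 * (c 1 * c 6) - 4 * (c 11 * (c 2 + c 3 + c 4 + c 5 + c 8 + c 9)) -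
        2 * (c 2 * (c 10 + c 13) + c 3 * (c 10 + c 12) + c 4 * (c 7 + c 13) + c 5 * (c 7 + c 12)) := by
  have hsplit : ∀ i j : Fin 15, (kerS3 i j : ℝ) * c i * c j =
      (kerU i j : ℝ) * c i * c j + 2 * ((indK s3Top i j : ℝ) * c i * c j) - 2 * ((indK s3B i j : ℝ) * c i * c j) := by
    intro i j; unfold kerS3; push_cast; ring
  simp_rw [hsplit, Finset.sum_sub_distrib, Finset.sum_add_distrib, ← Finset.mul_sum]
  rw [sum_kerU_cell, sum_indK_cell, sum_indK_cell]
  have hT : (∑ p ∈ s3Top, c p.1 * c p.2) = 2 * (c 0 * c 11) := by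
    unfold s3Top; rw [Finset.sum_insert (by decide), Finset.sum_singleton]; ring
  have hB : (∑ p ∈ s3B, c p.1 * c p.2) = 2 * (c 1 * c 6) := by
    unfold s3B; rw [Finset.sum_insert (by decide), Finset.sum_singleton]; ring
  rw [hT, hB]; ring

/-- **`S3 ≥ 0` for all `n` from its kernel (the reduction).**  If `kerS3` is a good kernel, then for every finite weighted graph
and all marked points, `4c₁c₆ + 4c₁₁·ΣD° + 2·darts ≤ 4c₀(c₁₁+c₁₄)`. [this work] -/
theorem packS3_of_goodKernel (hK : GoodKernel kerS3) (w : Sym2 (Fin n) → unitInterval) (a b c y : Fin n) :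
    4 * (cell w a b c y 1 * cell w a b c y 6) +
      4 * (cell w a b c y 11 * (cell w a b c y 2 + cell w a b c y 3 + cell w a b c y 4 + cell w a b c y 5 + cell w a b c y 8 +
        cell w a b c y 9)) +
      2 * (cell w a b c y 2 * (cell w a b c y 10 + cell w a b c y 13) + cell w a b c y 3 * (cell w a b c y 10 + cell w a b c y 12) +
        cell w a b c y 4 * (cell w a b c y 7 + cell w a b c y 13) + cell w a b c y 5 * (cell w a b c y 7 + cell w a b c y 12)) ≤
      4 * (cell w a b c y 0 * (cell w a b c y 11 + cell w a b c y 14)) := by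
  have h := sum_kernel_cell_nonneg hK w a b c y
  rw [sum_kerS3_cell] at h
  linarith

end TwoCopyMono

end Summit.CriticalPhenomena.PercolationContinuityZ3.Theorems
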